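import Mathlib
import HarnessLib
import Literature.Analysis.FluidPDE.PlanarPolarCoords
import Summits.NavierStokesRegularity.NavierStokesRegularity.Theorems.HalfSpaceWindowDoorCirculationCarryingRigidityDefs
import Summits.NavierStokesRegularity.NavierStokesRegularity.Theorems.HalfSpaceWindowDoorCirculationCarryingRigidityEddyTorqueOneSidedLiouville
import Summits.NavierStokesRegularity.NavierStokesRegularity.Theorems.HalfSpaceWindowDoorCirculationCarryingRigidityAxisCirculation
import Summits.NavierStokesRegularity.NavierStokesRegularity.Theorems.AxisTwistDoorAveragedConeLiouvilleCircMonotone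
import Summits.NavierStokesRegularity.NavierStokesRegularity.Theorems.AxisTwistDoorAveragedConeLiouvilleCylFrame

/-!
# Route `HalfSpaceWindowDoor`, crux `CirculationCarryingRigidity` (stmt-NavierStokesRegularity-25311) — census row in the TIME-ONLY
# class: the FINITE-PLANAR-ENERGY stratum is dead (a closed-hemisphere profile whose slices have square-integrable traces on the
# horizontal planes is poloidal)

LEAD ns-hsw-p1 g6 (cell pub-ns-dss), `--supports 25311 --as helper`.

THE OBSERVATION.  For a closed-hemisphere profile (`ω₃ = ⟪curl v, e₃⟫ ≥ 0`) the disc circulation `Γ(r,c,s) = ∮_{S(r,c)} v·e_θ dl =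
∫_{D(r,c)} ω₃` is non-negative and NON-DECREASING in `r` (tree: `…CircMonotone.circ_mono`), so on every horizontal plane it increases to
the plane flux `Φ(c,s) ∈ [0,∞]` (the «circulation at infinity» of the enemy, conserved and positive in the space–time Type-I subclass by
`…PlaneFluxDichotomy`).  On the other hand `Γ(r,c,s) ≤ r∫₀^{2π}‖v(s)(r,θ,c)‖dθ ≤ π r λ + (r/2λ)∫₀^{2π}‖v‖²dθ` for every `λ > 0`, so once
`Γ(r₀,c,s) = γ > 0` the radial marginal of the planar kinetic energy satisfies `r∫₀^{2π}‖v(s)(r,θ,c)‖²dθ ≥ γ²/(2π r)` for all `r ≥ r₀`,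
which is NOT integrable at infinity.  Hence:

* `circ_eq_zero_of_planarEnergy` — if the trace `y ↦ v(s)(y,c)` of one slice on one horizontal plane is square-integrable
  (`∫_{ℝ²}‖v(s)(y,c)‖²dy < ∞`), then `Γ(r,c,s) = 0` for every `r ≥ 0`;
* `circ_eq_zero_of_planarEnergy_dense` — if at time `s` the heights of finite planar energy are DENSE, then `Γ(r,c,s) = 0` for all
  `r ≥ 0` and ALL `c` (`c ↦ Γ(r,c,s)` is continuous: `continuous_circ_height`);
* `inner_curl_e3_eq_zero_of_planarEnergy_dense` / `inner_curl_e3_eq_zero_of_planarEnergy` — **CENSUS THEOREM (finite planar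
  energy).**  A profile of the route's Type-I ancient Oseen-mild class (time-only rate `‖v(t,·)‖ ≤ C/√(−t)`, continuity, the
  Oseen–Duhamel identity, divergence-free slices) with `ω₃ ≥ 0` whose every slice has square-integrable traces on a dense set of
  (resp. on all) horizontal planes is POLOIDAL (`ω₃ ≡ 0`); in particular no such profile carries circulation.  No axis-Type-I /
  space–time bound, no eddy hypothesis.  (A profile with `v(s) ∈ L²(ℝ³)` for every `s` has square-integrable traces on almost
  every, hence densely many, planes — the Fubini step is not typed here.)

SHARPNESS OF THE EXPONENT (remark, not typed): the argument runs verbatim for planar `L^p` traces with `p ≤ 2` (Hölder on the circle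
gives `r∫‖v‖^p dθ ≳ γ^p r^{1−p}`, non-integrable at infinity iff `p ≤ 2`), and `p = 2` is the end-point: the point-vortex tail
`|v_h| ∼ Φ₀/(2πr)` of a circulation-carrying profile is in `L^p(ℝ²)` exactly for `p > 2`.  CENSUS READING: the enemy of W6 has
INFINITE planar kinetic energy on every horizontal plane at every time (its swirl decays no faster than `Φ₀/(2π|x_h|)`); every
finite-energy-per-plane scenario (in particular `v(s)|_{x₃ = c} ∈ L²(ℝ²)` for all `c`, `s`) is excluded.  Compare the time-only rows of
`…TimeOnlyOutflow/…TimeOnlyExcess` (eddy-torque hypotheses) and the Gaussian rows R/R⁺/R′ of line «gauss-swirl» (inflow hypotheses):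
this row needs no dynamics at all beyond the class regularity — it is the kinematic floor under all of them.

WHAT THIS IS NOT: not a statement about Navier–Stokes regularity (Clay A); door statements are regularity CRITERIA about HYPOTHETICAL
blow-up profiles (KNSS ancient mild solutions); item 25311 stays OPEN at its research stub.
-/

noncomputable section

-- the summit and its single sub-problem share the name (CONVENTIONS §1), as in every Theorems file
set_option linter.dupNamespace false

namespace Summit.NavierStokesRegularity.NavierStokesRegularity.Theorems.HalfSpaceWindowDoorCirculationCarryingRigidityPlanarEnergy

open Set Function Filter MeasureTheory Topology intervalIntegral
open scoped InnerProductSpace RealInnerProductSpace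
open Literature.Analysis Literature.Analysis.FluidPDE
open Summit.NavierStokesRegularity.NavierStokesRegularity.Theorems.HalfSpaceWindowDoorCirculationCarryingRigidityDefs (planePt)
open Summit.NavierStokesRegularity.NavierStokesRegularity.Theorems.AxisTwistDoorAveragedConeLiouvilleDefs (cylPt eT circ SignE3)
open Summit.NavierStokesRegularity.NavierStokesRegularity.Theorems.AveragedConeLiouville.CircMonotone (circ_nonneg circ_mono)
open Summit.NavierStokesRegularity.NavierStokesRegularity.Theorems.AxisTwistDoorAveragedConeLiouvilleCylFrame
  (abs_inner_eT_le continuous_cylPt_θ)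
open Summit.NavierStokesRegularity.NavierStokesRegularity.Theorems.AveragedConeLiouville.CircleStokes
  (continuous_eT continuous_eR cylPt_eq_smul_eR)
open Summit.NavierStokesRegularity.NavierStokesRegularity.Theorems.HalfSpaceWindowDoorCirculationCarryingRigidityAxisCirculation
  (isSmoothSpaceTimeOn_of_class)
open Summit.NavierStokesRegularity.NavierStokesRegularity.Theorems.HalfSpaceWindowDoorCirculationCarryingRigidityEddyTorqueOneSidedLiouville
  (poloidal_of_circF_eq_zero)

variable {v : ℝ → EuclideanSpace ℝ (Fin 3) → EuclideanSpace ℝ (Fin 3)}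

/-! ### Circle geometry: the plane point over a polar circle point is the cylinder point -/

/-- `planePt c (circlePt ρ θ) = cylPt ρ θ c`. -/
theorem planePt_circlePt (c ρ θ : ℝ) : planePt c (circlePt ρ θ) = cylPt ρ θ c := by
  ext i
  fin_cases i <;> simp [planePt, circlePt, cylPt]

/-- The angular energy `θ ↦ ‖v(s)(cylPt ρ θ c)‖²` is `2π`-periodic. -/
theorem periodic_normSq_cylPt (s c ρ : ℝ) :
    Function.Periodic (fun θ : ℝ => ‖v s (cylPt ρ θ c)‖ ^ 2) (2 * Real.pi) := by
  intro θ
  simp only [← planePt_circlePt, periodic_circlePt ρ θ]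

/-! ### The elementary bounds on one circle -/

/-- **`Γ ≤ r∫‖v‖`**: the circulation through the circle `S(r,c)` is at most `r ∫₀^{2π} ‖v(s)(r,θ,c)‖ dθ` (`r ≥ 0`). -/
theorem circ_le_mul_integral_norm {s c r : ℝ} (hr : 0 ≤ r) (hv : Continuous (v s)) :
    circ v r c s ≤ r * ∫ θ in (0 : ℝ)..(2 * Real.pi), ‖v s (cylPt r θ c)‖ := by
  unfold circ
  rw [intervalIntegral.integral_mul_const, mul_comm]
  refine mul_le_mul_of_nonneg_left ?_ hr
  have h2π : (0 : ℝ) ≤ 2 * Real.pi := by positivity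
  refine intervalIntegral.integral_mono_on h2π ?_ ?_ fun θ _ => ?_
  · exact ((hv.comp (continuous_cylPt_θ r c)).inner (continuous_eT)).intervalIntegrable _ _
  · exact (hv.comp (continuous_cylPt_θ r c)).norm.intervalIntegrable _ _
  · exact (le_abs_self _).trans (abs_inner_eT_le _ θ)

/-- **AM–GM on the circle**: `∫₀^{2π}‖v‖ ≤ πλ + (2λ)⁻¹∫₀^{2π}‖v‖²` for every `λ > 0`. -/
theorem integral_norm_le_amgm {s c r lam : ℝ} (hlam : 0 < lam) (hv : Continuous (v s)) :
    ∫ θ in (0 : ℝ)..(2 * Real.pi), ‖v s (cylPt r θ c)‖ ≤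
      Real.pi * lam + (2 * lam)⁻¹ * ∫ θ in (0 : ℝ)..(2 * Real.pi), ‖v s (cylPt r θ c)‖ ^ 2 := by
  have h2π : (0 : ℝ) ≤ 2 * Real.pi := by positivity
  have hc : Continuous fun θ : ℝ => ‖v s (cylPt r θ c)‖ := (hv.comp (continuous_cylPt_θ r c)).norm
  have hpt : ∀ θ : ℝ, ‖v s (cylPt r θ c)‖ ≤ lam / 2 + (2 * lam)⁻¹ * ‖v s (cylPt r θ c)‖ ^ 2 := by
    intro θ
    set a := ‖v s (cylPt r θ c)‖
    have hkey : 0 ≤ (a - lam) ^ 2 := sq_nonneg _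
    have h2 : lam / 2 + (2 * lam)⁻¹ * a ^ 2 - a = (2 * lam)⁻¹ * (a - lam) ^ 2 := by
      field_simp
      ring
    nlinarith [mul_nonneg (inv_nonneg.2 (by positivity : (0 : ℝ) ≤ 2 * lam)) hkey]
  calc ∫ θ in (0 : ℝ)..(2 * Real.pi), ‖v s (cylPt r θ c)‖
      ≤ ∫ θ in (0 : ℝ)..(2 * Real.pi), (lam / 2 + (2 * lam)⁻¹ * ‖v s (cylPt r θ c)‖ ^ 2) :=
        intervalIntegral.integral_mono_on h2π (hc.intervalIntegrable _ _)
          ((continuous_const.add (continuous_const.mul (hc.pow 2))).intervalIntegrable _ _) fun θ _ => by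
            simpa using hpt θ
    _ = Real.pi * lam + (2 * lam)⁻¹ * ∫ θ in (0 : ℝ)..(2 * Real.pi), ‖v s (cylPt r θ c)‖ ^ 2 := by
        have hc2 : Continuous fun θ : ℝ => (2 * lam)⁻¹ * ‖v s (cylPt r θ c)‖ ^ 2 := continuous_const.mul (hc.pow 2)
        rw [intervalIntegral.integral_add intervalIntegrable_const (hc2.intervalIntegrable _ _),
          intervalIntegral.integral_const, intervalIntegral.integral_const_mul]
        simp only [sub_zero, smul_eq_mul]
        ring

/-- **The radial energy floor.**  If `Γ(r,c,s) ≥ γ > 0` at radius `r > 0`, then `r∫₀^{2π}‖v‖²dθ ≥ γ²/(2π r)`. -/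
theorem radial_energy_ge {s c r γ : ℝ} (hr : 0 < r) (hγ : 0 < γ) (hv : Continuous (v s)) (hΓ : γ ≤ circ v r c s) :
    γ ^ 2 / (2 * Real.pi * r) ≤ r * ∫ θ in (0 : ℝ)..(2 * Real.pi), ‖v s (cylPt r θ c)‖ ^ 2 := by
  set E := ∫ θ in (0 : ℝ)..(2 * Real.pi), ‖v s (cylPt r θ c)‖ ^ 2 with hE
  have hπ : 0 < Real.pi := Real.pi_pos
  -- λ = γ/(2πr)
  have hlam : 0 < γ / (2 * Real.pi * r) := by positivity
  have h1 := circ_le_mul_integral_norm (c := c) (s := s) hr.le hv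
  have h2 := integral_norm_le_amgm (c := c) (s := s) (r := r) hlam hv
  have h3 : γ ≤ r * (Real.pi * (γ / (2 * Real.pi * r)) + (2 * (γ / (2 * Real.pi * r)))⁻¹ * E) :=
    hΓ.trans (h1.trans (mul_le_mul_of_nonneg_left h2 hr.le))
  -- simplify: r·π·γ/(2πr) = γ/2 and r·(2γ/(2πr))⁻¹·E = π r² E/γ
  have h4 : r * (Real.pi * (γ / (2 * Real.pi * r)) + (2 * (γ / (2 * Real.pi * r)))⁻¹ * E) =
      γ / 2 + Real.pi * r ^ 2 / γ * E := by
    field_simp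
  rw [h4] at h3
  have h5 : γ / 2 ≤ Real.pi * r ^ 2 / γ * E := by linarith
  rw [div_le_iff₀ (by positivity)]
  have h6 := mul_le_mul_of_nonneg_left h5 (by positivity : (0 : ℝ) ≤ 2 * γ)
  have h7 : 2 * γ * (Real.pi * r ^ 2 / γ * E) = r * E * (2 * Real.pi * r) := by
    field_simp
  nlinarith [h6, h7]

/-! ### From planar square-integrability to the radial marginal -/

/-- **Polar marginal of the planar energy.**  If `y ↦ ‖v(s)(y,c)‖²` is integrable on `ℝ²`, then
`ρ ↦ ρ∫₀^{2π}‖v(s)(cylPt ρ θ c)‖²dθ` is integrable on `(0,∞)`. -/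
theorem integrableOn_radial_energy {s c : ℝ}
    (hint : Integrable (fun ξ : EuclideanSpace ℝ (Fin 2) => ‖v s (planePt c ξ)‖ ^ 2)) :
    IntegrableOn (fun ρ : ℝ => ρ * ∫ θ in (0 : ℝ)..(2 * Real.pi), ‖v s (cylPt ρ θ c)‖ ^ 2) (Ioi 0) := by
  have h := integrableOn_integral_norm_circlePt_smul hint
  refine h.congr_fun (fun ρ hρ => ?_) measurableSet_Ioi
  have hρ0 : 0 < ρ := hρ
  have hin : ∀ θ : ℝ, ‖ρ • ‖v s (planePt c (circlePt ρ θ))‖ ^ 2‖ = ρ * ‖v s (cylPt ρ θ c)‖ ^ 2 := by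
    intro θ
    rw [planePt_circlePt, smul_eq_mul, Real.norm_eq_abs, abs_of_nonneg (by positivity)]
  simp_rw [hin]
  rw [MeasureTheory.integral_const_mul]
  congr 1
  -- `∫_{(-π,π]} = ∫_{-π}^{π} = ∫_0^{2π}` by periodicity
  rw [← intervalIntegral.integral_of_le (by linarith [Real.pi_pos] : -Real.pi ≤ Real.pi)]
  have hper := (periodic_normSq_cylPt (v := v) s c ρ).intervalIntegral_add_eq (-Real.pi) 0
  simp only [zero_add] at hper
  rw [← hper]
  congr 1
  ring

/-! ### The circulation of a finite-planar-energy slice vanishes -/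

/-- **`Γ ≡ 0` on a plane of finite energy.**  For a `C¹` slice with `ω₃ ≥ 0` (so that `Γ(·,c,s)` is non-negative and non-decreasing):
if `y ↦ ‖v(s)(y,c)‖²` is integrable on `ℝ²` then `Γ(r,c,s) = 0` for every `r ≥ 0`. -/
theorem circ_eq_zero_of_planarEnergy {s c : ℝ} (hs : s < 0) (hv1 : ContDiff ℝ 1 (v s)) (hsign : SignE3 v)
    (hint : Integrable (fun ξ : EuclideanSpace ℝ (Fin 2) => ‖v s (planePt c ξ)‖ ^ 2)) :
    ∀ r : ℝ, 0 ≤ r → circ v r c s = 0 := by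
  have hvc : Continuous (v s) := hv1.continuous
  by_contra hcon
  push Not at hcon
  obtain ⟨r₀, hr₀, hne⟩ := hcon
  have hγ : 0 < circ v r₀ c s := lt_of_le_of_ne (circ_nonneg v hv1 hsign hs hr₀ c) (Ne.symm hne)
  set γ := circ v r₀ c s with hγdef
  -- work on the ray `(r₁, ∞)` with `r₁ = max r₀ 1 > 0`
  set r₁ := max r₀ 1 with hr₁
  have hr₁pos : 0 < r₁ := lt_of_lt_of_le one_pos (le_max_right _ _)
  have hmono : ∀ ρ, r₁ < ρ → γ ≤ circ v ρ c s := fun ρ hρ =>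
    circ_mono v hv1 hsign hs hr₀ ((le_max_left _ _).trans hρ.le) c
  -- the radial marginal is integrable on `(r₁, ∞)` …
  have hI : IntegrableOn (fun ρ : ℝ => ρ * ∫ θ in (0 : ℝ)..(2 * Real.pi), ‖v s (cylPt ρ θ c)‖ ^ 2) (Ioi r₁) :=
    (integrableOn_radial_energy hint).mono_set (Ioi_subset_Ioi hr₁pos.le)
  -- … and dominates `γ²/(2π) · ρ⁻¹` there, which is not integrable
  have hdom : IntegrableOn (fun ρ : ℝ => ρ ^ (-1 : ℝ)) (Ioi r₁) := by
    have hI' := hI.const_mul (2 * Real.pi / γ ^ 2)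
    refine hI'.mono' ?_ ?_
    · exact (measurable_id.pow_const _).aestronglyMeasurable
    · refine (ae_restrict_iff' measurableSet_Ioi).2 (Eventually.of_forall fun ρ hρ1 => ?_)
      have hρ : 0 < ρ := hr₁pos.trans hρ1
      have hfl := radial_energy_ge hρ hγ hvc (hmono ρ hρ1)
      rw [Real.norm_eq_abs, abs_of_nonneg (by positivity), Real.rpow_neg_one]
      have : ρ⁻¹ = 2 * Real.pi / γ ^ 2 * (γ ^ 2 / (2 * Real.pi * ρ)) := by
        field_simp
      rw [this]
      exact mul_le_mul_of_nonneg_left hfl (by positivity)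
  have hnot : ¬ IntegrableOn (fun ρ : ℝ => ρ ^ (-1 : ℝ)) (Ioi r₁) := by
    rw [integrableOn_Ioi_rpow_iff hr₁pos]
    norm_num
  exact hnot hdom

/-! ### Continuity of the circulation in the height -/

/-- `c ↦ Γ(r,c,s)` is continuous for a continuous slice. -/
theorem continuous_circ_height {s : ℝ} (hv : Continuous (v s)) (r : ℝ) : Continuous fun c : ℝ => circ v r c s := by
  unfold circ
  have hj : Continuous fun p : ℝ × ℝ => cylPt r p.2 p.1 := by
    have : (fun p : ℝ × ℝ => cylPt r p.2 p.1) = fun p => r • AxisTwistDoorAveragedConeLiouvilleDefs.eR p.2 + p.1 •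
        AxisTwistDoorAveragedConeLiouvilleDefs.e3 := funext fun p => cylPt_eq_smul_eR r p.2 p.1
    rw [this]
    refine Continuous.add ?_ ?_
    · exact (continuous_eR.comp continuous_snd).const_smul r
    · exact continuous_fst.smul continuous_const
  have hf : Continuous (Function.uncurry fun (c θ : ℝ) => ⟪v s (cylPt r θ c), eT θ⟫_ℝ * r) :=
    ((hv.comp hj).inner (continuous_eT.comp continuous_snd)).mul continuous_const
  exact intervalIntegral.continuous_parametric_intervalIntegral_of_continuous' hf 0 (2 * Real.pi)

/-- **`Γ ≡ 0` at a time whose finite-energy planes are dense in height.**  If at time `s < 0` the set of heights `c` with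
`∫_{ℝ²}‖v(s)(y,c)‖²dy < ∞` is dense, then `Γ(r,c,s) = 0` for ALL `r ≥ 0` and ALL `c` (continuity of `Γ` in `c`). -/
theorem circ_eq_zero_of_planarEnergy_dense {s : ℝ} (hs : s < 0) (hv1 : ContDiff ℝ 1 (v s)) (hsign : SignE3 v)
    (hdense : Dense {c : ℝ | Integrable (fun ξ : EuclideanSpace ℝ (Fin 2) => ‖v s (planePt c ξ)‖ ^ 2)}) :
    ∀ r : ℝ, 0 ≤ r → ∀ c : ℝ, circ v r c s = 0 := by
  intro r hr
  have hclosed : IsClosed {c : ℝ | circ v r c s = 0} := isClosed_eq (continuous_circ_height hv1.continuous r) continuous_const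
  have hsub : {c : ℝ | Integrable (fun ξ : EuclideanSpace ℝ (Fin 2) => ‖v s (planePt c ξ)‖ ^ 2)} ⊆ {c : ℝ | circ v r c s = 0} :=
    fun c hc => circ_eq_zero_of_planarEnergy hs hv1 hsign hc r hr
  have huniv : {c : ℝ | circ v r c s = 0} = univ := by
    apply eq_univ_of_univ_subset
    rw [← (hdense.mono hsub).closure_eq]
    exact closure_minimal subset_rfl hclosed |>.trans subset_rfl
  intro c
  have := huniv ▸ mem_univ c
  exact this

/-! ### The census theorem -/

/-- **CENSUS THEOREM (finite planar energy on a dense set of planes ⇒ poloidal), TIME-ONLY class.**  A profile of the route's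
Type-I ancient Oseen-mild class with `ω₃ = ⟪curl v, e₃⟫ ≥ 0` such that, at every time `s < 0`, the heights `c` whose plane trace
`y ↦ v(s)(y,c)` is square-integrable on `ℝ²` are DENSE, is POLOIDAL: `⟪curl v(s), e₃⟫ ≡ 0`. -/
theorem inner_curl_e3_eq_zero_of_planarEnergy_dense (C : ℝ)
    (v : ℝ → EuclideanSpace ℝ (Fin 3) → EuclideanSpace ℝ (Fin 3))
    (hrate : HasTypeITimeDecay C v)
    (hcont : ContinuousOn (uncurry v) (Iio (0 : ℝ) ×ˢ univ))
    (hmild : ∀ s t : ℝ, s < t → t < 0 → ∀ x,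
      v t x = UnboundedOperators.heatExtension (v s) (t - s) x - oseenDuhamel 1 s v v t x)
    (hdiv : ∀ t < 0, VectorCalculus.IsDivFree (v t))
    (hsign : ∀ s < 0, ∀ y, 0 ≤ ⟪curl (v s) y, (EuclideanSpace.single (2 : Fin 3) (1 : ℝ))⟫_ℝ)
    (hL2 : ∀ s < 0, Dense {c : ℝ | Integrable (fun ξ : EuclideanSpace ℝ (Fin 2) => ‖v s (planePt c ξ)‖ ^ 2)}) :
    ∀ s < 0, ∀ y, ⟪curl (v s) y, (EuclideanSpace.single (2 : Fin 3) (1 : ℝ))⟫_ℝ = 0 := by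
  have hsm : IsSmoothSpaceTimeOn (Iio (0 : ℝ)) v := isSmoothSpaceTimeOn_of_class hrate hcont hmild hdiv
  have hsign' : SignE3 v := hsign
  refine poloidal_of_circF_eq_zero hrate hcont hmild hdiv hsign' fun t ht x => ?_
  have hv1 : ContDiff ℝ 1 (v t) := (hsm.contDiff_slice ht).of_le (by norm_cast)
  rw [circ_eq_zero_of_planarEnergy_dense ht hv1 hsign' (hL2 t ht) (cylRadius x) (cylRadius_nonneg x) (x 2), mul_zero]



/-- **CENSUS THEOREM (finite planar energy ⇒ poloidal), TIME-ONLY class.**  A profile of the route's Type-I ancient Oseen-mild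
class with `ω₃ = ⟪curl v, e₃⟫ ≥ 0` whose slices have square-integrable traces on every horizontal plane
(`∫_{ℝ²} ‖v(s)(y, c)‖² dy < ∞` for all `s < 0`, `c ∈ ℝ`) is POLOIDAL: `⟪curl v(s), e₃⟫ ≡ 0`. -/
theorem inner_curl_e3_eq_zero_of_planarEnergy (C : ℝ)
    (v : ℝ → EuclideanSpace ℝ (Fin 3) → EuclideanSpace ℝ (Fin 3))
    (hrate : HasTypeITimeDecay C v)
    (hcont : ContinuousOn (uncurry v) (Iio (0 : ℝ) ×ˢ univ))
    (hmild : ∀ s t : ℝ, s < t → t < 0 → ∀ x,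
      v t x = UnboundedOperators.heatExtension (v s) (t - s) x - oseenDuhamel 1 s v v t x)
    (hdiv : ∀ t < 0, VectorCalculus.IsDivFree (v t))
    (hsign : ∀ s < 0, ∀ y, 0 ≤ ⟪curl (v s) y, (EuclideanSpace.single (2 : Fin 3) (1 : ℝ))⟫_ℝ)
    (hL2 : ∀ s < 0, ∀ c : ℝ, Integrable (fun ξ : EuclideanSpace ℝ (Fin 2) => ‖v s (planePt c ξ)‖ ^ 2)) :
    ∀ s < 0, ∀ y, ⟪curl (v s) y, (EuclideanSpace.single (2 : Fin 3) (1 : ℝ))⟫_ℝ = 0 :=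
  inner_curl_e3_eq_zero_of_planarEnergy_dense C v hrate hcont hmild hdiv hsign fun s hs =>
    (dense_univ.mono fun c _ => hL2 s hs c)

/-- The same census theorem with the sign hypothesis and conclusion spelled with the route's `e3`. -/
theorem inner_curl_e3_eq_zero_of_planarEnergy' (C : ℝ)
    (v : ℝ → EuclideanSpace ℝ (Fin 3) → EuclideanSpace ℝ (Fin 3))
    (hrate : HasTypeITimeDecay C v)
    (hcont : ContinuousOn (uncurry v) (Iio (0 : ℝ) ×ˢ univ))
    (hmild : ∀ s t : ℝ, s < t → t < 0 → ∀ x,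
      v t x = UnboundedOperators.heatExtension (v s) (t - s) x - oseenDuhamel 1 s v v t x)
    (hdiv : ∀ t < 0, VectorCalculus.IsDivFree (v t))
    (hsign : ∀ s < 0, ∀ y, 0 ≤ ⟪curl (v s) y,
      Summit.NavierStokesRegularity.NavierStokesRegularity.Theorems.HalfSpaceWindowDoorCirculationCarryingRigidityDefs.e3⟫_ℝ)
    (hL2 : ∀ s < 0, ∀ c : ℝ, Integrable (fun ξ : EuclideanSpace ℝ (Fin 2) => ‖v s (planePt c ξ)‖ ^ 2)) :
    ∀ s < 0, ∀ y, ⟪curl (v s) y,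
      Summit.NavierStokesRegularity.NavierStokesRegularity.Theorems.HalfSpaceWindowDoorCirculationCarryingRigidityDefs.e3⟫_ℝ = 0 :=
  inner_curl_e3_eq_zero_of_planarEnergy C v hrate hcont hmild hdiv hsign hL2

/-! ### Appendix (same seat): FINITE ENERGY ⇒ finite planar energy on almost every plane (Fubini) ⇒ poloidal -/

/-- **Fubini: finite energy ⇒ finite planar energy on almost every plane.**  If `‖v(s)‖²` is integrable on `ℝ³`, then for almost
every height `c` the plane trace `y ↦ ‖v(s)(y,c)‖²` is integrable on `ℝ²` (the plane-slicing equivalence `ℝ × ℝ² ≃ᵐ ℝ³`,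
`(c, ξ) ↦ planePt c ξ`, is volume-preserving). -/
theorem ae_integrable_planar_sq {s : ℝ} (hint : Integrable (fun x : EuclideanSpace ℝ (Fin 3) => ‖v s x‖ ^ 2)) :
    ∀ᵐ c : ℝ, Integrable (fun ξ : EuclideanSpace ℝ (Fin 2) => ‖v s (planePt c ξ)‖ ^ 2) := by
  -- the plane-slicing equivalence `ℝ × ℝ² ≃ᵐ ℝ³`, `(c, ξ) ↦ planePt c ξ`
  set T : ℝ × EuclideanSpace ℝ (Fin 2) ≃ᵐ EuclideanSpace ℝ (Fin 3) :=
    ((MeasurableEquiv.prodCongr (MeasurableEquiv.refl ℝ) (MeasurableEquiv.toLp 2 (Fin 2 → ℝ)).symm).trans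
      (MeasurableEquiv.piFinSuccAbove (fun _ => ℝ) 2).symm).trans (MeasurableEquiv.toLp 2 (Fin 3 → ℝ)) with hT
  have hTmp : MeasurePreserving T (volume.prod volume) volume := by
    refine (MeasurePreserving.trans ?_ (volume_preserving_piFinSuccAbove (fun _ => ℝ) 2).symm).trans
      (PiLp.volume_preserving_toLp (Fin 3))
    have h2 : MeasurePreserving (MeasurableEquiv.toLp 2 (Fin 2 → ℝ)).symm volume volume :=
      EuclideanSpace.volume_preserving_symm_measurableEquiv_toLp (Fin 2)
    exact (MeasurePreserving.id volume).prod h2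
  have hTapply : ∀ c : ℝ, ∀ ξ : EuclideanSpace ℝ (Fin 2), T (c, ξ) = planePt c ξ := by
    intro c ξ
    ext i
    fin_cases i <;> rfl
  have hcomp : Integrable (fun p : ℝ × EuclideanSpace ℝ (Fin 2) => ‖v s (T p)‖ ^ 2) (volume.prod volume) :=
    (hTmp.integrable_comp_emb T.measurableEmbedding).2 hint
  have hae := hcomp.prod_right_ae
  refine hae.mono fun c hc => ?_
  simpa [hTapply] using hc

/-- Finite energy at time `s` makes the finite-planar-energy heights dense (a.e. ⇒ dense). -/
theorem dense_planar_sq {s : ℝ} (hint : Integrable (fun x : EuclideanSpace ℝ (Fin 3) => ‖v s x‖ ^ 2)) :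
    Dense {c : ℝ | Integrable (fun ξ : EuclideanSpace ℝ (Fin 2) => ‖v s (planePt c ξ)‖ ^ 2)} :=
  Measure.dense_of_ae (ae_integrable_planar_sq hint)

/-- **CENSUS THEOREM (finite energy ⇒ poloidal), TIME-ONLY class.**  A profile of the route's Type-I ancient Oseen-mild class with
`ω₃ = ⟪curl v, e₃⟫ ≥ 0` and FINITE KINETIC ENERGY at every time (`∫_{ℝ³}‖v(s)‖² < ∞` for all `s < 0`) is POLOIDAL: `⟪curl v(s), e₃⟫ ≡ 0`.
(So the circulation-carrying enemy of W6 has infinite energy at every time — consistent with its point-vortex tail `Φ₀/(2π|x_h|)`.) -/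
theorem inner_curl_e3_eq_zero_of_finiteEnergy (C : ℝ)
    (v : ℝ → EuclideanSpace ℝ (Fin 3) → EuclideanSpace ℝ (Fin 3))
    (hrate : HasTypeITimeDecay C v)
    (hcont : ContinuousOn (uncurry v) (Iio (0 : ℝ) ×ˢ univ))
    (hmild : ∀ s t : ℝ, s < t → t < 0 → ∀ x,
      v t x = UnboundedOperators.heatExtension (v s) (t - s) x - oseenDuhamel 1 s v v t x)
    (hdiv : ∀ t < 0, VectorCalculus.IsDivFree (v t))
    (hsign : ∀ s < 0, ∀ y, 0 ≤ ⟪curl (v s) y, (EuclideanSpace.single (2 : Fin 3) (1 : ℝ))⟫_ℝ)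
    (hE : ∀ s < 0, Integrable (fun x : EuclideanSpace ℝ (Fin 3) => ‖v s x‖ ^ 2)) :
    ∀ s < 0, ∀ y, ⟪curl (v s) y, (EuclideanSpace.single (2 : Fin 3) (1 : ℝ))⟫_ℝ = 0 :=
  inner_curl_e3_eq_zero_of_planarEnergy_dense C v hrate hcont hmild hdiv hsign fun s hs => dense_planar_sq (hE s hs)

end Summit.NavierStokesRegularity.NavierStokesRegularity.Theorems.HalfSpaceWindowDoorCirculationCarryingRigidityPlanarEnergy

end
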